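import Summits.ValiantsHypothesis.ValiantsHypothesis.Theorems.KPlusLogSqLawTridiagonalRealStaticPotentialRow
import Summits.ValiantsHypothesis.ValiantsHypothesis.Theorems.LacunarySymmetroidMatrixDescartesRolleSchurStep

/-!
# Route «KPlusLogSqLaw», crux `WeakLifting` (stmt-ValiantsHypothesis-19561) — REAL side of the tridiagonal sector:
# the CHRISTOFFEL–DARBOUX (Wronskian) identity for the continuants of a static symmetric tridiagonal design

HONEST FRAMING.  Helper (`--supports stmt-ValiantsHypothesis-19561 --as helper`), seat val-sym-lift-p2 (g11), cell `pub-symmetroid`,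
2026-08-28; α register (static definite tridiagonal row), UPPER side.  A KERNEL TOOL, no law: for the continuants
`D_k = pathDet a d b f k` (`D_{n+2} = a_{n+1} X^{d_{n+1}} D_{n+1} − (b_n X^{f_n})² D_n`, `…PotentialRow.pathDet_add_two`) and the
Wronskian `Wr(P, Q) = P′·Q − P·Q′` (derivative in `X`):
* `X_mul_wronskian_step` (all designs): `X·Wr(D_{n+2}, D_{n+1}) = a_{n+1}d_{n+1} X^{d_{n+1}} D_{n+1}² − 2 f_n b_n² X^{2f_n} D_n D_{n+1}
  + (b_n X^{f_n})²·X·Wr(D_{n+1}, D_n)` — one edge adds a weighted SQUARE of the last continuant, a link CROSS TERM (absent for constant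
  links), and transports the previous Wronskian with the positive weight `(b_n X^{f_n})²`;
* `X_mul_wronskian_eq_sum` (constant links, `f ≡ 0` — the «vertex gauge» of the cell): the closed CHRISTOFFEL–DARBOUX form
  `X·Wr(D_{k+1}, D_k) = Σ_{j ≤ k} (∏_{j ≤ i < k} b_i²) · a_j d_j · X^{d_j} · D_j²` — a combination of squares of ALL earlier continuants whose
  signs are the signs of `a_j d_j`;
* `wronskian_eval_nonneg` (constant links, `0 ≤ a_j`): at every `x > 0`, `(D_{k+1}′ D_k − D_{k+1} D_k′)(x) ≥ 0`, i.e. `D_{k+1}/D_k` is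
  non-decreasing between consecutive zeros of `D_k` (Sturm-type interlacing of consecutive continuants on the Loewner sector).
READING for the lineage (located/paper, memos HIERARCHICAL-LIMIT-GAME-liftp3g9 §6, COMPLEX-PAIR-ACCOUNTING-liftp2g10 §2(iii),
RAYLEIGH-SURFACE-liftp2g11 §5): the zeros of `D_{k+2}` in a positive cell of `R_{k+1} = D_{k+1}/D_k` are «parity + 2·(oscillations)», and the
oscillations are sign changes of Wronskian-type combinations; in the genuinely two-signed (Laurent) vertex gauge the same identity holds
with exponents `e_j` of both signs, `x·Wr = Σ (∏ b_i²) a_j e_j x^{e_j} D_j(x)²`, so consecutive continuants interlace on every window where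
that signed sum of squares keeps its sign — the exact algebraic face of the located fact that `Z(C_m)` reaches 4–5 at `m = 7` (no bounded
step).  This file records the algebra once, in the tree's `pathDet` currency (natural exponents; the two-signed form is the same computation
after the monomial congruence).  Nothing here bears on `WeakLifting` / `TropicalB` in their windows, Conjecture B, the Door-A registers,
`MatrixDescartes` (stmt-ValiantsHypothesis-18050) or VP ≠ VNP.  [folklore: Christoffel–Darboux / Sturm for three-term recurrences]
-/

set_option linter.dupNamespace false
set_option autoImplicit false

namespace Summit.ValiantsHypothesis.ValiantsHypothesis.Theorems.KPlusLogSqLaw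

namespace StaticTridiagonalRealPotential

open Polynomial Finset
open Summit.ValiantsHypothesis.ValiantsHypothesis.Theorems.LacunarySymmetroidMatrixDescartes.RolleSchur (X_mul_derivative_X_pow)

variable (a : ℕ → ℝ) (d : ℕ → ℕ) (b : ℕ → ℝ) (f : ℕ → ℕ)

/-- `X · (c X^n)′ = c n · X^n`. [folklore] -/
theorem X_mul_derivative_monomial (c : ℝ) (n : ℕ) :
    (X : ℝ[X]) * derivative (C c * (X : ℝ[X]) ^ n) = C (c * n) * X ^ n := by
  rw [derivative_C_mul, ← mul_assoc, mul_comm X (C c), mul_assoc, X_mul_derivative_X_pow, map_mul]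
  ring

/-- **One edge of the Christoffel–Darboux recursion** (all static symmetric tridiagonal designs):
`X·Wr(D_{n+2}, D_{n+1}) = a_{n+1} d_{n+1} X^{d_{n+1}} D_{n+1}² − 2 f_n b_n² X^{2 f_n} D_n D_{n+1} + (b_n X^{f_n})² · X·Wr(D_{n+1}, D_n)`,
where `Wr(P, Q) = P′Q − PQ′`. [folklore: Christoffel–Darboux / Sturm] -/
theorem X_mul_wronskian_step (n : ℕ) :
    (X : ℝ[X]) * (derivative (pathDet a d b f (n + 2)) * pathDet a d b f (n + 1)
        - pathDet a d b f (n + 2) * derivative (pathDet a d b f (n + 1))) =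
      C (a (n + 1) * (d (n + 1) : ℝ)) * X ^ d (n + 1) * pathDet a d b f (n + 1) ^ 2
        - C (2 * (f n : ℝ) * b n ^ 2) * X ^ (2 * f n) * pathDet a d b f n * pathDet a d b f (n + 1)
        + (C (b n) * X ^ f n) ^ 2 * ((X : ℝ[X]) * (derivative (pathDet a d b f (n + 1)) * pathDet a d b f n
            - pathDet a d b f (n + 1) * derivative (pathDet a d b f n))) := by
  have hA : (X : ℝ[X]) * derivative (C (a (n + 1)) * (X : ℝ[X]) ^ d (n + 1)) =
      C (a (n + 1) * (d (n + 1) : ℝ)) * X ^ d (n + 1) := X_mul_derivative_monomial _ _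
  have hB2 : (C (b n) * (X : ℝ[X]) ^ f n) ^ 2 = C (b n ^ 2) * X ^ (2 * f n) := by
    rw [mul_pow, ← map_pow, ← pow_mul, mul_comm (f n) 2]
  have hB : (X : ℝ[X]) * derivative ((C (b n) * (X : ℝ[X]) ^ f n) ^ 2) =
      C (2 * (f n : ℝ) * b n ^ 2) * X ^ (2 * f n) := by
    rw [hB2, X_mul_derivative_monomial]
    congr 1
    simp only [Nat.cast_mul, Nat.cast_ofNat, map_mul]
    ring
  have hrec : pathDet a d b f (n + 2) =
      (C (a (n + 1)) * X ^ d (n + 1)) * pathDet a d b f (n + 1) - (C (b n) * X ^ f n) ^ 2 * pathDet a d b f n :=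
    pathDet_add_two a d b f n
  set P := pathDet a d b f (n + 1) with hP
  set Q := pathDet a d b f n with hQ
  set A := C (a (n + 1)) * (X : ℝ[X]) ^ d (n + 1) with hAdef
  set B := (C (b n) * (X : ℝ[X]) ^ f n) ^ 2 with hBdef
  rw [hrec, derivative_sub, derivative_mul (f := A) (g := P), derivative_mul (f := B) (g := Q)]
  linear_combination (P ^ 2) * hA - (Q * P) * hB

/-- **The Christoffel–Darboux identity in the vertex gauge** (constant links, `f ≡ 0`): for every `k`,
`X·Wr(D_{k+1}, D_k) = Σ_{j ≤ k} (∏_{j ≤ i < k} b_i²) · (a_j d_j) · X^{d_j} · D_j²` — the Wronskian of consecutive continuants is a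
combination of SQUARES of all earlier continuants with coefficients `(∏ b_i²)·a_j·d_j`. [folklore: Christoffel–Darboux] -/
theorem X_mul_wronskian_eq_sum (hf : ∀ t, f t = 0) (k : ℕ) :
    (X : ℝ[X]) * (derivative (pathDet a d b f (k + 1)) * pathDet a d b f k
        - pathDet a d b f (k + 1) * derivative (pathDet a d b f k)) =
      ∑ j ∈ range (k + 1), C ((∏ i ∈ Ico j k, b i ^ 2) * (a j * (d j : ℝ))) * X ^ d j * pathDet a d b f j ^ 2 := by
  induction k with
  | zero =>
    simp only [zero_add, pathDet_one, pathDet_zero, derivative_one, mul_zero, sub_zero, mul_one, range_one,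
      sum_singleton, Ico_self, prod_empty, one_mul, one_pow]
    exact X_mul_derivative_monomial _ _
  | succ n ih =>
    have hstep := X_mul_wronskian_step a d b f n
    rw [hf n] at hstep
    simp only [Nat.cast_zero, mul_zero, zero_mul, map_zero, sub_zero, pow_zero, mul_one] at hstep
    have hR : (∑ j ∈ range (n + 1 + 1), C ((∏ i ∈ Ico j (n + 1), b i ^ 2) * (a j * (d j : ℝ))) * X ^ d j *
        pathDet a d b f j ^ 2) =
        (∑ j ∈ range (n + 1), C ((∏ i ∈ Ico j (n + 1), b i ^ 2) * (a j * (d j : ℝ))) * X ^ d j *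
          pathDet a d b f j ^ 2) + C (a (n + 1) * (d (n + 1) : ℝ)) * X ^ d (n + 1) * pathDet a d b f (n + 1) ^ 2 := by
      rw [Finset.sum_range_succ, Ico_self, prod_empty, one_mul]
    have hT : ∀ j ∈ range (n + 1), C ((∏ i ∈ Ico j (n + 1), b i ^ 2) * (a j * (d j : ℝ))) * X ^ d j *
        pathDet a d b f j ^ 2 =
        C (b n) ^ 2 * (C ((∏ i ∈ Ico j n, b i ^ 2) * (a j * (d j : ℝ))) * X ^ d j * pathDet a d b f j ^ 2) := by
      intro j hj
      have hjn : j ≤ n := Nat.lt_succ_iff.mp (mem_range.mp hj)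
      rw [Finset.prod_Ico_succ_top hjn]
      simp only [map_mul, map_pow]
      ring
    rw [hstep, ih, hR, Finset.sum_congr rfl hT, ← Finset.mul_sum, add_comm]

/-- **Sturm-type monotonicity on the Loewner sector** (constant links, nonnegative diagonal coefficients): at every `x > 0`,
`D_{k+1}′(x) D_k(x) − D_{k+1}(x) D_k′(x) ≥ 0`; hence `D_{k+1}/D_k` is non-decreasing between consecutive zeros of `D_k`, and consecutive
continuants interlace there. [folklore: Sturm] -/
theorem wronskian_eval_nonneg (hf : ∀ t, f t = 0) (ha : ∀ t, 0 ≤ a t) (k : ℕ) {x : ℝ} (hx : 0 < x) :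
    0 ≤ (derivative (pathDet a d b f (k + 1)) * pathDet a d b f k
        - pathDet a d b f (k + 1) * derivative (pathDet a d b f k)).eval x := by
  have h := congrArg (fun p : ℝ[X] => p.eval x) (X_mul_wronskian_eq_sum a d b f hf k)
  simp only [eval_mul, eval_X] at h
  have hsum : 0 ≤ (∑ j ∈ range (k + 1), C ((∏ i ∈ Ico j k, b i ^ 2) * (a j * (d j : ℝ))) * X ^ d j *
      pathDet a d b f j ^ 2).eval x := by
    rw [eval_finsetSum]
    refine sum_nonneg fun j _ => ?_
    simp only [eval_mul, eval_C, eval_pow, eval_X]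
    have h1 : 0 ≤ ∏ i ∈ Ico j k, b i ^ 2 := prod_nonneg fun i _ => sq_nonneg _
    have h2 : 0 ≤ a j * (d j : ℝ) := mul_nonneg (ha j) (Nat.cast_nonneg _)
    have h3 : 0 ≤ x ^ d j := pow_nonneg hx.le _
    have h4 : 0 ≤ (pathDet a d b f j).eval x ^ 2 := sq_nonneg _
    exact mul_nonneg (mul_nonneg (mul_nonneg h1 h2) h3) h4
  rw [← h] at hsum
  exact (mul_nonneg_iff_of_pos_left hx).mp hsum

/-! ## Appendix (same seat): STURM INTERLACING on the Loewner sector with nonzero links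

With constant links (`f ≡ 0`), positive diagonal coefficients, nonzero links and a nonconstant first diagonal entry (`0 < d 0`), the Wronskian is
STRICTLY positive at every `x > 0` (the `j = 0` square in `X_mul_wronskian_eq_sum` is `(∏ b_i²) a₀ d₀ X^{d₀}`), so `D_{k+1}/D_k` is strictly increasing on
every interval of `(0, ∞)` free of zeros of `D_k`; consequently `D_{k+1}` has at most one zero between consecutive positive zeros of `D_k`. -/

/-- **Strict positivity of the Wronskian** (constant links, `0 < a_j`, links `b_i ≠ 0`, `0 < d₀`): at every `x > 0`,
`D_{k+1}′(x) D_k(x) − D_{k+1}(x) D_k′(x) > 0`. [folklore: Sturm / Christoffel–Darboux] -/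
theorem wronskian_eval_pos (hf : ∀ t, f t = 0) (ha : ∀ t, 0 < a t) (hb : ∀ t, b t ≠ 0) (hd : 0 < d 0) (k : ℕ)
    {x : ℝ} (hx : 0 < x) :
    0 < (derivative (pathDet a d b f (k + 1)) * pathDet a d b f k
        - pathDet a d b f (k + 1) * derivative (pathDet a d b f k)).eval x := by
  have h := congrArg (fun p : ℝ[X] => p.eval x) (X_mul_wronskian_eq_sum a d b f hf k)
  simp only [eval_mul, eval_X] at h
  -- every term of the sum is nonnegative and the `j = 0` term is positive
  have hterm : ∀ j ∈ range (k + 1), 0 ≤ (C ((∏ i ∈ Ico j k, b i ^ 2) * (a j * (d j : ℝ))) * X ^ d j *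
      pathDet a d b f j ^ 2).eval x := by
    intro j _
    simp only [eval_mul, eval_C, eval_pow, eval_X]
    have h1 : 0 ≤ ∏ i ∈ Ico j k, b i ^ 2 := prod_nonneg fun i _ => sq_nonneg _
    have h2 : 0 ≤ a j * (d j : ℝ) := mul_nonneg (ha j).le (Nat.cast_nonneg _)
    exact mul_nonneg (mul_nonneg (mul_nonneg h1 h2) (pow_nonneg hx.le _)) (sq_nonneg _)
  have h0 : 0 < (C ((∏ i ∈ Ico 0 k, b i ^ 2) * (a 0 * (d 0 : ℝ))) * X ^ d 0 *
      pathDet a d b f 0 ^ 2).eval x := by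
    simp only [eval_mul, eval_C, eval_pow, eval_X, pathDet_zero, one_pow, mul_one]
    have h1 : 0 < ∏ i ∈ Ico 0 k, b i ^ 2 := prod_pos fun i _ => pow_pos (abs_pos.mpr (hb i)) 2 |>.trans_eq (sq_abs _)
    have h2 : 0 < a 0 * (d 0 : ℝ) := mul_pos (ha 0) (Nat.cast_pos.mpr hd)
    exact mul_pos (mul_pos h1 h2) (pow_pos hx _)
  have hsum : 0 < (∑ j ∈ range (k + 1), C ((∏ i ∈ Ico j k, b i ^ 2) * (a j * (d j : ℝ))) * X ^ d j *
      pathDet a d b f j ^ 2).eval x := by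
    rw [eval_finsetSum]
    exact lt_of_lt_of_le h0 (single_le_sum (f := fun j => (C ((∏ i ∈ Ico j k, b i ^ 2) * (a j * (d j : ℝ))) * X ^ d j *
          pathDet a d b f j ^ 2).eval x) hterm (mem_range.mpr (Nat.succ_pos k)))
  rw [← h] at hsum
  exact (mul_pos_iff_of_pos_left hx).mp hsum

/-- **`D_{k+1}/D_k` is strictly increasing** on every closed interval `[u, v] ⊂ (0, ∞)` on which `D_k` has no zero (constant links, `0 < a_j`,
nonzero links, `0 < d₀`). [folklore: Sturm] -/
theorem strictMonoOn_ratio (hf : ∀ t, f t = 0) (ha : ∀ t, 0 < a t) (hb : ∀ t, b t ≠ 0) (hd : 0 < d 0) (k : ℕ)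
    {u v : ℝ} (hu : 0 < u) (hk : ∀ x ∈ Set.Icc u v, (pathDet a d b f k).eval x ≠ 0) :
    StrictMonoOn (fun x => (pathDet a d b f (k + 1)).eval x / (pathDet a d b f k).eval x) (Set.Icc u v) := by
  set P := pathDet a d b f (k + 1) with hP
  set Q := pathDet a d b f k with hQ
  have hderiv : ∀ x ∈ Set.Icc u v, HasDerivAt (fun y => P.eval y / Q.eval y)
      (((derivative P).eval x * Q.eval x - P.eval x * (derivative Q).eval x) / (Q.eval x) ^ 2) x := by
    intro x hx
    exact (P.hasDerivAt x).div (Q.hasDerivAt x) (hk x hx)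
  refine strictMonoOn_of_deriv_pos (convex_Icc u v) ?_ ?_
  · exact fun x hx => (hderiv x hx).continuousAt.continuousWithinAt
  · intro x hx
    rw [interior_Icc] at hx
    have hx' : x ∈ Set.Icc u v := Set.Ioo_subset_Icc_self hx
    rw [(hderiv x hx').deriv]
    have hxpos : 0 < x := hu.trans hx.1
    have hW := wronskian_eval_pos a d b f hf ha hb hd k hxpos
    simp only [eval_sub, eval_mul] at hW
    exact div_pos hW (pow_pos (abs_pos.mpr (hk x hx')) 2 |>.trans_eq (sq_abs _))

/-- **Sturm interlacing (one half)**: between two consecutive positive zeros of `D_k` — more generally on any `[u, v] ⊂ (0, ∞)` free of zeros of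
`D_k` — the next continuant `D_{k+1}` has AT MOST ONE zero (constant links, `0 < a_j`, nonzero links, `0 < d₀`). [folklore: Sturm] -/
theorem atMostOne_root_next (hf : ∀ t, f t = 0) (ha : ∀ t, 0 < a t) (hb : ∀ t, b t ≠ 0) (hd : 0 < d 0) (k : ℕ)
    {u v : ℝ} (hu : 0 < u) (hk : ∀ x ∈ Set.Icc u v, (pathDet a d b f k).eval x ≠ 0)
    {x₁ x₂ : ℝ} (h₁ : x₁ ∈ Set.Icc u v) (h₂ : x₂ ∈ Set.Icc u v)
    (r₁ : (pathDet a d b f (k + 1)).eval x₁ = 0) (r₂ : (pathDet a d b f (k + 1)).eval x₂ = 0) : x₁ = x₂ := by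
  have hmono := strictMonoOn_ratio a d b f hf ha hb hd k hu hk
  have e : (fun x => (pathDet a d b f (k + 1)).eval x / (pathDet a d b f k).eval x) x₁ =
      (fun x => (pathDet a d b f (k + 1)).eval x / (pathDet a d b f k).eval x) x₂ := by
    simp only [r₁, r₂, zero_div]
  exact hmono.injOn h₁ h₂ e

end StaticTridiagonalRealPotential

end Summit.ValiantsHypothesis.ValiantsHypothesis.Theorems.KPlusLogSqLaw
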